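import Summits.QuantumFields.YangMills.Theorems.BalabanUVNodesN11Thm2AlongSupplyChain
import Literature.MathematicalPhysics.QuantumFieldTheory.Balaban1983to89.T4WilsonGaugeFlatDirection

/-!
# DAG node N11 — A6 FOR THEOREM 2 OF RECORD, KEYED: the keyed sentence is INHABITED NON-TRIVIALLY at the PURE-GAUGE class `{U = 1^u}` for EVERY witness family carrying
# the inductive hypothesis's gauge invariance (r11's `LFHyp.gaugeInvE ∕ gaugeInvR`, (2.27)(iii) — inside def-T's `LawsRT`, hence along dag-n11-e's chain), with `E₁ = R₁ = 0`

Cell `pub-ymgap`, YM-PLAN Track A (HUMAN RULING D-0062 ∕ D-0149), seat `pub-ymgap-dag-n11-w2` (g2), route `BalabanUVNodes`, key item K1⁷ `StabilityBAtRecordR13SepCoPH` =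
stmt-QuantumFields-20542 (helper, count-neutral).  [III] = [Balaban1988Convergent], [I] = [Balaban1987RG1].  Over g2's keyed Defs (p600092) ∕ `…Thm2OfRecordKeyed` (p601222, whose
§4 A6 is the UNIT class) ∕ `…Thm2AlongSupplyChain` (p603501: `lawsRT_chainWitness_of_chainFormAt`), dag-n11-e's `chainFormAt_all_of_obligations`, lit-balaban's
`T4WilsonGaugeFlatDirection.plaqHol_gaugeAct`, def-T's `Sect2.cAct` ∕ `towerOfTerms_act` ∕ `Setting.Laws`.

WHY THIS FILE.  dag-n13-w2 g3's END theorem (`…N13Cor3AsymJunctionThm2KeyedFullBudgetAtRecord13CoPH`) and g2's chain edges CONSUME `B14.Thm2Printed` on the keyed carrier as a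
HYPOTHESIS; g2 FILE C §4 inhabits it only at the unit class `𝒰 ≡ {1}` (both sides `0` at `U = 1`).  THIS FILE gives the honest structural inhabitant print's own invariance
predicts: at every PURE-GAUGE configuration `U = 1^u` (`GaugeField.gaugeAct u 1`) the (2.43) ∕ (2.44) left-hand sides VANISH for ANY witness whose terms are gauge invariant in
the sense of the inductive hypothesis (2.27)(iii) — `𝐄^{(j)}(X, (ι(1^u), 0), z) = 𝐄^{(j)}(X, (ι1, 0)^{ιu}, z) = 𝐄^{(j)}(X, (ι1, 0), z)` (`LFHyp.gaugeInvE`; the pair `(ι(1^u), 0)` IS the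
tower's action of the lifted transformation on `(ι1, 0)`, §1), `A(φ, 1^u) = 0` (`plaqHol_gaugeAct`, `reTr_conj`), likewise `𝐑^{(j)}` (`gaugeInvR`) — so `B14Thm2.Ineq243 ∕ Ineq244`
and `B14.Thm2Printed` hold on the keyed carrier of the pure-gauge class with `E₁ = R₁ = 0`, for every witness family with def-T's `Sect2.LawsRT` at every history (e.g. dag-n11-e's
chain witness under `ChainFormAt`, i.e. under `SupplierObligations ∧ NoExpansionObligation` on the live-selector line).  The unit class is the case `u = 1`.

WHAT THIS FILE PROVES (0 `sorry`, 0 `def`, standard axioms; count-neutral; nothing of Bałaban's asserted).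
§1 generic (any setting with `Laws`): `ofBackgroundC_gaugeAct_one_eq_cAct` (`(ι(1^u), 0) = (ι1, 0)^{ιu}` in def-T's `Φ`) · `plaqHol_gaugeAct_one` · `smearedWilson_gaugeAct_one` (`A(w, 1^u) = 0`).
§2 at the tower of record of `(s, t)` under `Step.LFHyp … k`: `E_re_gaugeAct_one_eq` · `R_re_gaugeAct_one_eq` (vacuum-subtracted 𝐄 ∕ 𝐑 summands vanish at `1^u`, `j ≤ k`) ·
   `EjSub_gaugeAct_one_eq_zero` · `rSum_gaugeAct_one_eq_zero`.
§3 ★ `ineq243_keyed_pureGauge_of_lawsRT` · ★ `ineq244_keyed_pureGauge_of_lawsRT` (`E₁ = R₁ = 0` on the pure-gauge class, given `LawsRT` of the witness at every `k ≤ K`, `s`) ·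
   ★★ `thm2Printed_keyed_pureGauge_of_lawsRT` · ★★ `thm2Printed_keyed_pureGauge_chainWitness_of_obligations` (along dag-n11-e's chain on the live-selector line: from
   `(hσ, hT)` + def-T's provisos ONLY) — the A2∕A6 inhabitant of the consumers' Theorem-2 hypothesis beyond the unit configuration.

HONEST FRAMING.  An A6∕consistency certificate: it shows the keyed Theorem-2 sentence is compatible with (and at flat configurations forced by) the inductive hypothesis's gauge
invariance; it says NOTHING about non-flat configurations, where Theorem 2 is [III] §3's analysis (the supply tokens, displayed elsewhere).  N11 NOT discharged; K1⁷ NOT closed;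
counts unmoved (typed 28∕28 · discharged 5∕27).  One finite four-torus programme at fixed `ε = L^{−K}`; R4 closes only the conditional finite-𝕋⁴ rung `BalabanLadder.UV`; NOT ℝ⁴,
NOT OS, NOT the Yang–Mills mass gap (Clay), which none of this proves.
Sources: [III] (2.27)(iii) p.259, (2.30) p.260, Thm 2 p.263; [I] (1.10) p.262; [Balaban1985Averaging] (8)–(12) p.19 (gauge action).
-/

noncomputable section

open scoped BigOperators Matrix.Norms.L2Operator

namespace Summit.QuantumFields.YangMills.Theorems.BalabanUVNodesN11Thm2OfRecordKeyedPureGauge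

open Literature.MathematicalPhysics.QuantumFieldTheory.Balaban1983to89 Step B14.Eq225Concrete B14.LocalCoupling B14Thm2 Finset
open T4Continuum Node00 B15DeterminingSets
open BalabanUVNodesN11Sect3SupplyChainDefs (Sect3Supplier chainWitness)
open BalabanUVNodesN11Sect3SupplyChainObligationsDefs (SupplierObligations NoExpansionObligation chainFormAt_all_of_obligations)
open BalabanUVNodesN11Thm2Sect2DataOfRecordKeyedDefs
open BalabanUVNodesN11Thm2AlongSupplyChain (lawsRT_chainWitness_of_chainFormAt)

/-! ## §1. Generic: the pure-gauge pair is the action of the lifted transformation on the unit pair; `A(w, 1^u) = 0` -/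

section Generic

variable {P : Params} {𝔸 : Type*} [Ring 𝔸] {G : Type*} [GaugeGroup G]

/-- **`(ι(1^u), 0) = (ι1, 0)^{ιu}`**: the pair of a pure-gauge configuration is def-T's action `cAct` of the embedded transformation on the unit pair.
[cite: Balaban1987RG1, (1.10) p.262; Balaban1985Averaging, (8) p.19] -/
theorem ofBackgroundC_gaugeAct_one_eq_cAct (ι : G →* 𝔸ˣ) (u : GaugeTransf P 0 G) :
    Sect2.ofBackgroundC (P := P) ι (GaugeField.gaugeAct u 1) = Sect2.cAct (fun x => ι (u x)) (Sect2.ofBackgroundC (P := P) ι 1) := by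
  refine Prod.ext (funext fun b => ?_) (funext fun b => ?_)
  · show (ι (u b.src * (1 : GaugeField P 0 G) b * (u b.tgt)⁻¹) : 𝔸) = (ι (u b.src) : 𝔸) * (ι ((1 : GaugeField P 0 G) b) : 𝔸) * ((ι (u b.tgt))⁻¹ : 𝔸ˣ)
    have e1 : (1 : GaugeField P 0 G) b = 1 := rfl
    rw [e1, map_mul, map_mul, map_inv, map_one, Units.val_mul, Units.val_mul]
  · show (0 : 𝔸) = (ι (u b.src) : 𝔸) * 0 * ((ι (u b.src))⁻¹ : 𝔸ˣ)
    rw [mul_zero, zero_mul]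

/-- **`(1^u)(∂p) = u(p₋)·1·u(p₋)⁻¹`** (lit-balaban's `plaqHol_gaugeAct`). [cite: Balaban1985Averaging, (9)–(12) p.19] -/
theorem plaqHol_gaugeAct_one {j : ℕ} (u : GaugeTransf P j G) (p : Plaq P j) :
    GaugeField.plaqHol (GaugeField.gaugeAct u 1) p = u p.src * 1 * (u p.src)⁻¹ := by
  rw [T4WilsonGaugeFlatDirection.plaqHol_gaugeAct]
  have e : ∀ b : PBond P j, (1 : GaugeField P j G) b = 1 := fun _ => rfl
  simp only [GaugeField.plaqHol, e, inv_one, mul_one]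

/-- **`A(w, 1^u) = 0`**: every plaquette variable of a pure gauge is a conjugate of `1` (`reTr_conj`, `reTr_one`). [cite: Balaban1988Convergent, (2.25) p.259; Balaban1985Averaging, (12) p.19] -/
theorem smearedWilson_gaugeAct_one (w : Plaq P 0 → ℝ) (u : GaugeTransf P 0 G) :
    smearedWilson w (GaugeField.gaugeAct u 1) = 0 := by
  unfold smearedWilson
  refine Finset.sum_eq_zero fun q _ => ?_
  rw [plaqHol_gaugeAct_one, GaugeGroup.reTr_conj, GaugeGroup.reTr_one, sub_self, mul_zero]

end Generic

/-! ## §2. At the tower of record of `(s, t)`: the vacuum-subtracted 𝐄 ∕ 𝐑 summands vanish at pure gauges under the inductive hypothesis's gauge invariance -/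

section AtRecord13

variable {F : T4Family} {N : ℕ} [NeZero N]
variable (θ : Stage13HParams F N) (p : B12.RunParams) {k : ℕ}

/-- **`Re 𝐄^{(j)}(X,(ι(1^u),0),z) = Re 𝐄^{(j)}(X,(ι1,0),z)`** at the tower of record, `1 ≤ j ≤ k`, from `LFHyp.gaugeInvE` with the transformation lifted into the model's `Gᶜ`
(`settingOfRecord₁₃_laws`: `ι(SU N) ⊆ G ⊆ Gᶜ`). [cite: Balaban1988Convergent, (2.27)(iii) p.259] -/
theorem E_re_gaugeAct_one_eq (s : SeqOfRecord F θ.ν θ.τ9.M (gOfRecord₁₃ F N θ.toStage13Params p) p.K k)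
    (t : Sect2.TermValues (F.P p.K) (MatA N) (FluctV N) θ.τ9.M) {c : LFConsts}
    (hlaw : LFHyp (sect2TowerOfRecord F N (FluctV N) p.K (settingOfRecord₁₃ F N θ.toStage13Params p) (θ.rzAt p s) s t) c k)
    {j : ℕ} (hj : 1 ≤ j) (hjk : j ≤ k) (X : (Sect2.domSys (F.P p.K) θ.τ9.M j).Dom) (z : Site (F.P p.K) j) (g : ℝ) (u : GaugeTransf (F.P p.K) 0 (SU N)) :
    t.E j X z g (Sect2.ofBackgroundC (ιSU N) (GaugeField.gaugeAct u 1)) = t.E j X z g (Sect2.ofBackgroundC (ιSU N) 1) := by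
  have hS := settingOfRecord₁₃_laws F N θ.toStage13Params p
  have h := hlaw.gaugeInvE j hj hjk X z g (fun x => ⟨ιSU N (u x), hS.G_le_Gc (hS.ι_mem (u x))⟩) (Sect2.ofBackgroundC (ιSU N) 1)
  rw [ofBackgroundC_gaugeAct_one_eq_cAct]
  exact h

/-- **`Re 𝐑^{(j)}(X,(ι(1^u),0)) = Re 𝐑^{(j)}(X,(ι1,0))`** at the tower of record, `1 ≤ j ≤ k` (`LFHyp.gaugeInvR`). [cite: Balaban1988Convergent, (2.27)(iii) p.259, (2.30) p.260] -/
theorem R_gaugeAct_one_eq (s : SeqOfRecord F θ.ν θ.τ9.M (gOfRecord₁₃ F N θ.toStage13Params p) p.K k)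
    (t : Sect2.TermValues (F.P p.K) (MatA N) (FluctV N) θ.τ9.M) {c : LFConsts}
    (hlaw : LFHyp (sect2TowerOfRecord F N (FluctV N) p.K (settingOfRecord₁₃ F N θ.toStage13Params p) (θ.rzAt p s) s t) c k)
    {j : ℕ} (hj : 1 ≤ j) (hjk : j ≤ k) (X : (Sect2.domSys (F.P p.K) θ.τ9.M j).Dom) (u : GaugeTransf (F.P p.K) 0 (SU N)) :
    t.R j X (Sect2.ofBackgroundC (ιSU N) (GaugeField.gaugeAct u 1)) = t.R j X (Sect2.ofBackgroundC (ιSU N) 1) := by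
  have hS := settingOfRecord₁₃_laws F N θ.toStage13Params p
  have h := hlaw.gaugeInvR j hj hjk X (fun x => ⟨ιSU N (u x), hS.G_le_Gc (hS.ι_mem (u x))⟩) (Sect2.ofBackgroundC (ιSU N) 1)
  rw [ofBackgroundC_gaugeAct_one_eq_cAct]
  exact h

/-- **The (2.25) summand `EjSub` vanishes at a pure gauge** (`1 ≤ j ≤ k`, any range). [cite: Balaban1988Convergent, (2.25)–(2.27) p.259] -/
theorem EjSub_gaugeAct_one_eq_zero (s : SeqOfRecord F θ.ν θ.τ9.M (gOfRecord₁₃ F N θ.toStage13Params p) p.K k)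
    (t : Sect2.TermValues (F.P p.K) (MatA N) (FluctV N) θ.τ9.M) {c : LFConsts}
    (hlaw : LFHyp (sect2TowerOfRecord F N (FluctV N) p.K (settingOfRecord₁₃ F N θ.toStage13Params p) (θ.rzAt p s) s t) c k)
    {j : ℕ} (hj : 1 ≤ j) (hjk : j ≤ k) (admE : (j : ℕ) → (Sect2.domSys (F.P p.K) θ.τ9.M j).Dom → Site (F.P p.K) j → Bool) (u : GaugeTransf (F.P p.K) 0 (SU N)) :
    EjSub (sect2TowerOfRecord F N (FluctV N) p.K (settingOfRecord₁₃ F N θ.toStage13Params p) (θ.rzAt p s) s t) admE j (GaugeField.gaugeAct u 1) = 0 := by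
  unfold EjSub
  refine Finset.sum_eq_zero fun X _ => Finset.sum_eq_zero fun z _ => ?_
  split_ifs
  · show (t.E j X z _ (Sect2.ofBackgroundC (ιSU N) (GaugeField.gaugeAct u 1))).re - (t.E j X z _ (Sect2.ofBackgroundC (ιSU N) 1)).re = 0
    rw [E_re_gaugeAct_one_eq θ p s t hlaw hj hjk, sub_self]
  · rfl

open Classical in
/-- **The (2.30)-type range sum of `Re[𝐑^{(j)}(X,U) − 𝐑^{(j)}(X,1)]` vanishes at a pure gauge** (`1 ≤ j ≤ k`, any range). [cite: Balaban1988Convergent, (2.30) p.260] -/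
theorem rSum_gaugeAct_one_eq_zero (s : SeqOfRecord F θ.ν θ.τ9.M (gOfRecord₁₃ F N θ.toStage13Params p) p.K k)
    (t : Sect2.TermValues (F.P p.K) (MatA N) (FluctV N) θ.τ9.M) {c : LFConsts}
    (hlaw : LFHyp (sect2TowerOfRecord F N (FluctV N) p.K (settingOfRecord₁₃ F N θ.toStage13Params p) (θ.rzAt p s) s t) c k)
    {j : ℕ} (hj : 1 ≤ j) (hjk : j ≤ k) (adm : (Sect2.domSys (F.P p.K) θ.τ9.M j).Dom → Bool) (u : GaugeTransf (F.P p.K) 0 (SU N)) :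
    ∑ X : (Sect2.domSys (F.P p.K) θ.τ9.M j).Dom, (if adm X then
        ((t.R j X (Sect2.ofBackgroundC (ιSU N) (GaugeField.gaugeAct u 1))).re - (t.R j X (Sect2.ofBackgroundC (ιSU N) 1)).re) else 0) = 0 := by
  refine Finset.sum_eq_zero fun X _ => ?_
  split_ifs
  · rw [R_gaugeAct_one_eq θ p s t hlaw hj hjk, sub_self]
  · rfl

/-! ## §3. The keyed Theorem 2 at the pure-gauge class -/

variable (𝒯 : (k : ℕ) → SeqOfRecord F θ.ν θ.τ9.M (gOfRecord₁₃ F N θ.toStage13Params p) p.K k → Sect2.TermValues (F.P p.K) (MatA N) (FluctV N) θ.τ9.M)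

open Classical in
/-- **★ (2.43) ON THE KEYED CARRIER OF THE PURE-GAUGE CLASS WITH `E₁ = 0`**, for every witness family with def-T's `Sect2.LawsRT` at every `k ≤ K` and history (its `LFHyp.gaugeInvE`),
every `L`, `β`. [cite: Balaban1988Convergent, Thm 2 (2.43) p.263, (2.27)(iii) p.259] -/
theorem ineq243_keyed_pureGauge_of_lawsRT
    (hlaw : ∀ k, k ≤ p.K → ∀ s : SeqOfRecord F θ.ν θ.τ9.M (gOfRecord₁₃ F N θ.toStage13Params p) p.K k,
      Sect2.LawsRT (sect2TowerOfRecord F N (FluctV N) p.K (settingOfRecord₁₃ F N θ.toStage13Params p) (θ.rzAt p s) s (𝒯 k s)) (settingOfRecord₁₃ F N θ.toStage13Params p).lf k)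
    (L β : ℝ) :
    Ineq243 (sect2DataOfRecord₁₃Keyed θ p 𝒯 (fun _ _ => {U | ∃ u : GaugeTransf (F.P p.K) 0 (SU N), U = GaugeField.gaugeAct u 1})) L β 0 := by
  intro j k ω hj hjk hk
  obtain ⟨k', d⟩ := ω
  rw [zero_mul]
  by_cases hk' : k' = k
  · subst hk'
    obtain ⟨u, hu⟩ := d.mem
    rw [eTerm_mk_self, hu, EjSub_gaugeAct_one_eq_zero θ p d.s (𝒯 k' d.s) (hlaw k' hk d.s).1 hj hjk, smearedWilson_gaugeAct_one, mul_zero, sub_zero, abs_zero]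
  · rw [eTerm_mk_of_ne θ p 𝒯 _ hk', abs_zero]

open Classical in
/-- **★ (2.44) ON THE KEYED CARRIER OF THE PURE-GAUGE CLASS WITH `R₁ = 0`** (`LFHyp.gaugeInvR`), every `κ₀`. [cite: Balaban1988Convergent, Thm 2 (2.44) p.263, (2.27)(iii) p.259, (2.30) p.260] -/
theorem ineq244_keyed_pureGauge_of_lawsRT
    (hlaw : ∀ k, k ≤ p.K → ∀ s : SeqOfRecord F θ.ν θ.τ9.M (gOfRecord₁₃ F N θ.toStage13Params p) p.K k,
      Sect2.LawsRT (sect2TowerOfRecord F N (FluctV N) p.K (settingOfRecord₁₃ F N θ.toStage13Params p) (θ.rzAt p s) s (𝒯 k s)) (settingOfRecord₁₃ F N θ.toStage13Params p).lf k)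
    (κ₀ : ℕ) :
    Ineq244 (sect2DataOfRecord₁₃Keyed θ p 𝒯 (fun _ _ => {U | ∃ u : GaugeTransf (F.P p.K) 0 (SU N), U = GaugeField.gaugeAct u 1})) 0 κ₀ := by
  intro j k ω hj hjk hk
  obtain ⟨k', d⟩ := ω
  rw [zero_mul, zero_mul]
  by_cases hk' : k' = k
  · subst hk'
    obtain ⟨u, hu⟩ := d.mem
    rw [rTerm_mk_self, hu, rSum_gaugeAct_one_eq_zero θ p d.s (𝒯 k' d.s) (hlaw k' hk d.s).1 hj hjk, abs_zero]
  · rw [rTerm_mk_of_ne θ p 𝒯 _ hk', abs_zero]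

/-- **★★ THEOREM 2 KEYED IS INHABITED AT THE PURE-GAUGE CLASS** with `E₁ = R₁ = 0`, for every witness family with `LawsRT` at every `k ≤ K` and history — every `H033`, `L`, `β`, `κ₀`.
[cite: Balaban1988Convergent, Thm 2 p.263, (2.27)(iii) p.259] -/
theorem thm2Printed_keyed_pureGauge_of_lawsRT
    (hlaw : ∀ k, k ≤ p.K → ∀ s : SeqOfRecord F θ.ν θ.τ9.M (gOfRecord₁₃ F N θ.toStage13Params p) p.K k,
      Sect2.LawsRT (sect2TowerOfRecord F N (FluctV N) p.K (settingOfRecord₁₃ F N θ.toStage13Params p) (θ.rzAt p s) s (𝒯 k s)) (settingOfRecord₁₃ F N θ.toStage13Params p).lf k)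
    (H033 : Flow → ℕ → Prop) (L β : ℝ) (κ₀ : ℕ) :
    B14.Thm2Printed H033 (fun _ : PUnit => sect2DataOfRecord₁₃Keyed θ p 𝒯 (fun _ _ => {U | ∃ u : GaugeTransf (F.P p.K) 0 (SU N), U = GaugeField.gaugeAct u 1})) L β κ₀ :=
  fun _ => ⟨0, 0, fun _ _ _ => ⟨ineq243_keyed_pureGauge_of_lawsRT θ p 𝒯 hlaw L β, ineq244_keyed_pureGauge_of_lawsRT θ p 𝒯 hlaw κ₀⟩⟩

/-- **★★ ALONG dag-n11-e's CHAIN ON THE LIVE-SELECTOR LINE**: from `SupplierObligations θ p σ ∧ NoExpansionObligation θ p σ` + def-T's provisos ONLY, Theorem 2 keyed to the chain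
witness holds at the pure-gauge class with `E₁ = R₁ = 0` (`chainFormAt_all_of_obligations` ⇒ `LawsRT` of the chain witness) — the consumers' Theorem-2 hypothesis is inhabited
beyond the unit configuration for the chain's own terms. [cite: Balaban1988Convergent, Thm 1 p.262, Thm 2 p.263, (2.27)(iii) p.259] -/
theorem thm2Printed_keyed_pureGauge_chainWitness_of_obligations (σ : Sect3Supplier θ p) (hprov : θ.Provisos₁₃CoPH F N)
    (hsel : θ.ppSel = ppSelLiveOfRecord F N θ.ν θ.τ9 (EOfRecord₁₃ F N θ.toStage13Params) (wOfRecord₉ F N θ.toStage9Params))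
    (hθ : θ.Admissible F N) (hκ : 0 ≤ θ.s2.lf.κ) (hE₀ : 0 ≤ θ.s2.lf.E₀) (hB₀ : 0 ≤ θ.s2.lf.B₀) (hM : 1 ≤ θ.τ9.M)
    (hσ : SupplierObligations θ p σ) (hT : NoExpansionObligation θ p σ) (H033 : Flow → ℕ → Prop) (L β : ℝ) (κ₀ : ℕ) :
    B14.Thm2Printed H033 (fun _ : PUnit => sect2DataOfRecord₁₃Keyed θ p (fun k s => (chainWitness θ p σ k).1 s)
      (fun _ _ => {U | ∃ u : GaugeTransf (F.P p.K) 0 (SU N), U = GaugeField.gaugeAct u 1})) L β κ₀ :=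
  thm2Printed_keyed_pureGauge_of_lawsRT θ p _ (fun k hk s =>
    lawsRT_chainWitness_of_chainFormAt θ p σ (chainFormAt_all_of_obligations hprov hsel hθ hκ hE₀ hB₀ hM σ hσ hT k hk) s) H033 L β κ₀

end AtRecord13

end Summit.QuantumFields.YangMills.Theorems.BalabanUVNodesN11Thm2OfRecordKeyedPureGauge

end
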